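import Mathlib
import HarnessLib
import Literature.Analysis.FluidPDE.NSBoundedMildAnalytic
import Literature.Analysis.FluidPDE.OseenSchemePicard
import Literature.Analysis.FluidPDE.OseenSchemeRealAnalytic
import Literature.Analysis.FluidPDE.OseenMildUniqueness
import Literature.Analysis.FluidPDE.NSBoundedMildSmoothing
import Literature.Analysis.Complex.HolomorphicParametricIntegral
import Literature.Analysis.Complex.OsgoodProofs
import Literature.Analysis.Fourier.TitchmarshPaleyWiener
import Literature.Analysis.UnboundedOperators.HeatKernel
import Summits.NavierStokesRegularity.NavierStokesRegularity.Theorems.LocalSineTubeDoorProfileAlignedWindowRigidityAncient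

/-!
# K2 `PoloidalWindowRigidity` (stmt-NavierStokesRegularity-19708) — LINE PAIRINGS OF AN OSEEN-ANCIENT FIELD ARE
# REAL-ANALYTIC IN THE BASE POINT; band-limitation of line restrictions propagates from a window to the slab
# (line `entire_slices`, rung `stub_expTypeTH`, step (C) of seat ns-es-p1 g2)

Seat ns-es-p1 g2 (`--supports stmt-NavierStokesRegularity-19708 --as helper`).

For a field `v` of the Oseen-ancient class 𝔄 (`uncurry v` continuous on the open slab `(−∞,0) × ℝ³`, bounded on every
sub-slab `(−∞,−δ)`, unit-viscosity Oseen-mild between negative times — the route's Type-I class lies in it,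
`…Ancient.bdd_of_hasTypeITimeDecay`), a direction `e ∈ ℝ³`, a component `i` and an integrable weight `ψ : ℝ → ℂ`, the
LINE PAIRING
`Φ(t, y) := ∫ v_i(t, y + s e) ψ(s) ds`
is JOINTLY REAL-ANALYTIC in `(t, y)` on the slab (`analyticOnNhd_linePairing`).  Consequently, if `Φ` vanishes on a
nonempty open space–time set it vanishes identically (`linePairing_eq_zero_of_open`), and — taking `ψ = 𝓕φ` for Schwartz
`φ` supported off a set `K` — the distributional Fourier support of the line restrictions `s ↦ v_i(t, y + s e)`
(`Literature.Analysis.Fourier.HasFourierSupportIn`, Hörmander Def. 7.1.9) PROPAGATES from the lines through a window to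
every line at every negative time (`hasFourierSupportIn_line_of_open`).  This is the step that carries the exponential-type
(band-limitation) clause of `stub_expTypeTH` from the window `W` up to the apex.

Mechanism (the tree's complexified Oseen scheme, Lemarié-Rieusset 2016 Thm 9.12 as PROVED in
`Literature.Analysis.FluidPDE.OseenSchemePicard` / `…OseenSchemeRealAnalytic`): near `(t₀, y₀)` restart at `s₀ < t₀`;
the local solution `u = picardLimitReal 1 (v s₀)` is the real restriction of the field `U = picardLimitC 1 (v s₀)`,
holomorphic and BOUNDED (`2K_G M`) in the parameters `(m, g) ∈ schemeDomain` UNIFORMLY in the space point, and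
Galilean-covariant; by the real boost identity, `u(t, y + s e) = U(Ψ_{y₀}(t, y))(y₀ + s e)` with the real-analytic
Galilean chart `Ψ_{y₀}` INDEPENDENT OF `s` — so `Φ = G ∘ Ψ_{y₀}` with `G(p) = ∫ U(p)(y₀ + s e)_i ψ(s) ds` holomorphic
(dominated holomorphic parameter integral, `Literature.Analysis.Complex.differentiableOn_integral_of_dominated`; Osgood);
`v = u(· − s₀)` near `(t₀, y₀)` by bounded-mild uniqueness (`oseenMild_bounded_unique`).

* `analyticOnNhd_linePairing_of_real_boost`, `analyticOnNhd_linePairing_shift_of_real_boost` — the chart step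
  (generalising `…OseenSchemeRealAnalytic.analyticOnNhd_uncurry_of_real_boost` from point values to line pairings);
* `analyticOnNhd_linePairing` — the class statement;
* `linePairing_eq_zero_of_open`, `hasFourierSupportIn_line_of_open` — propagation.

WHAT THIS IS NOT: not a claim about Navier–Stokes regularity, not the crux, not the rung — an analytic-continuation tool
for the class (bears_on LADDER-NS N0 via crux K2 = stmt-19708).  No summit statement is proved here.
-/

noncomputable section

-- the summit and its single sub-problem share the name (CONVENTIONS §1), as in every Theorems file
set_option linter.dupNamespace false

namespace Summit.NavierStokesRegularity.NavierStokesRegularity.Theorems.PoloidalWindowDoorPoloidalWindowRigidityLinePairing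

open Set Function Filter MeasureTheory Metric Topology
open scoped ENNReal FourierTransform
open Literature.Analysis Literature.Analysis.FluidPDE Literature.Analysis.Fourier
open Literature.Analysis.FunctionSpaces.EuclideanSpace (complexify complexify_apply)
open Summit.NavierStokesRegularity.NavierStokesRegularity.Theorems.LocalSineTubeDoorProfileAlignedWindowRigidityAncient

/-! ### The chart step: line pairings of the real restriction of a holomorphic covariant field -/

section Chart

variable {ι : Type*} [Fintype ι]

/-- **Line pairings are real-analytic in the base point (chart step).**  Let `Ω ⊆ ℂ × ℂ^ι` be open and contain the
real points `(√(νt), 0)`, `0 < t < T₀`; let `U : ℂ × ℂ^ι → ℝ^ι → ℂ^ι` be holomorphic in the parameters on `Ω` for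
every space point, continuous in the space point and bounded by `K` on `Ω`, and let `u` satisfy the real boost identity
`U(√(νt), cx h) x = cx (u(t, x − νt·h))`.  Then for every direction `e`, component `i` and integrable weight `ψ` the
line pairing `(t, y) ↦ ∫ u_i(t, y + s e) ψ(s) ds` is jointly real-analytic on `(0, T₀) × ℝ^ι`: near `(t⋆, y⋆)` it is
`G ∘ Ψ_{y⋆}` with `G(p) = ∫ U(p)(y⋆ + s e)_i ψ(s) ds` holomorphic on `Ω` and the Galilean chart `Ψ_{y⋆}` real-analytic. -/
theorem analyticOnNhd_linePairing_of_real_boost {ν T₀ : ℝ} (hν : 0 < ν)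
    {Ω : Set (ℂ × EuclideanSpace ℂ ι)} (hΩ : IsOpen Ω)
    (hΩreal : ∀ t ∈ Ioo 0 T₀,
      ((((Real.sqrt (ν * t) : ℝ) : ℂ), (0 : EuclideanSpace ℂ ι)) : ℂ × EuclideanSpace ℂ ι) ∈ Ω)
    {U : ℂ × EuclideanSpace ℂ ι → EuclideanSpace ℝ ι → EuclideanSpace ℂ ι}
    (hU : ∀ x, DifferentiableOn ℂ (fun p => U p x) Ω) (hUc : ∀ p ∈ Ω, Continuous (U p))
    {K : ℝ} (hUK : ∀ p ∈ Ω, ∀ x, ‖U p x‖ ≤ K)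
    {u : ℝ → EuclideanSpace ℝ ι → EuclideanSpace ℝ ι}
    (hboost : ∀ t ∈ Ioo 0 T₀, ∀ h x : EuclideanSpace ℝ ι,
      ((((Real.sqrt (ν * t) : ℝ) : ℂ), complexify h) : ℂ × EuclideanSpace ℂ ι) ∈ Ω →
        U (((Real.sqrt (ν * t) : ℝ) : ℂ), complexify h) x = complexify (u t (x - (ν * t) • h)))
    (e : EuclideanSpace ℝ ι) (i : ι) {ψ : ℝ → ℂ} (hψ : Integrable ψ) :
    AnalyticOnNhd ℝ (fun q : ℝ × EuclideanSpace ℝ ι => ∫ s, ((u q.1 (q.2 + s • e) i : ℝ) : ℂ) * ψ s)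
      (Ioo 0 T₀ ×ˢ (univ : Set (EuclideanSpace ℝ ι))) := by
  intro z hz
  obtain ⟨ht, -⟩ := mem_prod.1 hz
  set t₀ : ℝ := z.1
  set x₀ : EuclideanSpace ℝ ι := z.2
  -- the pairing of the complex field along the line through the base point, holomorphic in the parameters
  set G : ℂ × EuclideanSpace ℂ ι → ℂ := fun p => ∫ s, (U p (x₀ + s • e)) i * ψ s with hG
  have hGd : DifferentiableOn ℂ G Ω := by
    refine Complex.differentiableOn_integral_of_dominated (fun p hp => ?_)
      (Eventually.of_forall fun s => ?_) (fun p₀ hp₀ => ?_)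
    · have hl : Continuous fun s : ℝ => x₀ + s • e := continuous_const.add (continuous_id.smul continuous_const)
      have hc : Continuous fun s : ℝ => (U p (x₀ + s • e)) i :=
        (EuclideanSpace.proj (𝕜 := ℂ) i).continuous.comp ((hUc p hp).comp hl)
      exact hc.aestronglyMeasurable.mul hψ.aestronglyMeasurable
    · intro p hp
      exact ((EuclideanSpace.proj (𝕜 := ℂ) i).differentiableAt.comp_differentiableWithinAt p
        (hU (x₀ + s • e) p hp)).mul_const (ψ s)
    · obtain ⟨R, hR, hRΩ⟩ := Metric.isOpen_iff.1 hΩ p₀ hp₀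
      refine ⟨R, hR, hRΩ, fun s => K * ‖ψ s‖, hψ.norm.const_mul K, Eventually.of_forall fun s p hp => ?_⟩
      rw [norm_mul]
      exact mul_le_mul_of_nonneg_right ((PiLp.norm_apply_le _ i).trans (hUK p (hRΩ hp) _)) (norm_nonneg _)
  have hGan : AnalyticOnNhd ℂ G Ω := Complex.SCV.analyticOnNhd_of_differentiableOn hGd hΩ
  -- the Galilean chart at the base point
  have hΨz : galileanChart ν x₀ z = (((Real.sqrt (ν * t₀) : ℝ) : ℂ), 0) := by
    have : z = (t₀, x₀) := rfl
    rw [this, galileanChart_self]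
  have hmem : galileanChart ν x₀ z ∈ Ω := by rw [hΨz]; exact hΩreal t₀ ht
  have hΨan : AnalyticAt ℝ (galileanChart ν x₀) z := analyticAt_galileanChart hν x₀ ht.1
  have hcomp : AnalyticAt ℝ (fun q => G (galileanChart ν x₀ q)) z :=
    ((hGan _ hmem).restrictScalars (𝕜 := ℝ)).comp hΨan
  refine hcomp.congr ?_
  have hev1 : ∀ᶠ q in 𝓝 z, galileanChart ν x₀ q ∈ Ω :=
    hΨan.continuousAt.preimage_mem_nhds (hΩ.mem_nhds hmem)
  have hev2 : ∀ᶠ q : ℝ × EuclideanSpace ℝ ι in 𝓝 z, q.1 ∈ Ioo 0 T₀ :=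
    continuous_fst.continuousAt.preimage_mem_nhds (isOpen_Ioo.mem_nhds ht)
  filter_upwards [hev1, hev2] with q hq1 hq2
  have hνq : ν * q.1 ≠ 0 := (mul_pos hν hq2.1).ne'
  simp only [hG]
  refine integral_congr_ae (Eventually.of_forall fun s => ?_)
  have hb := hboost q.1 hq2 ((ν * q.1)⁻¹ • (x₀ - q.2)) (x₀ + s • e) hq1
  have hx : x₀ + s • e - (ν * q.1) • ((ν * q.1)⁻¹ • (x₀ - q.2)) = q.2 + s • e := by
    rw [smul_smul, mul_inv_cancel₀ hνq, one_smul]; abel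
  rw [hx] at hb
  show (U (galileanChart ν x₀ q) (x₀ + s • e)) i * ψ s = ((u q.1 (q.2 + s • e) i : ℝ) : ℂ) * ψ s
  unfold galileanChart
  rw [hb, complexify_apply]

/-- **The same from an arbitrary initial time `s₀`** (time translation is affine, hence analytic). -/
theorem analyticOnNhd_linePairing_shift_of_real_boost {ν T₀ : ℝ} (hν : 0 < ν)
    {Ω : Set (ℂ × EuclideanSpace ℂ ι)} (hΩ : IsOpen Ω)
    (hΩreal : ∀ t ∈ Ioo 0 T₀,
      ((((Real.sqrt (ν * t) : ℝ) : ℂ), (0 : EuclideanSpace ℂ ι)) : ℂ × EuclideanSpace ℂ ι) ∈ Ω)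
    {U : ℂ × EuclideanSpace ℂ ι → EuclideanSpace ℝ ι → EuclideanSpace ℂ ι}
    (hU : ∀ x, DifferentiableOn ℂ (fun p => U p x) Ω) (hUc : ∀ p ∈ Ω, Continuous (U p))
    {K : ℝ} (hUK : ∀ p ∈ Ω, ∀ x, ‖U p x‖ ≤ K)
    {u : ℝ → EuclideanSpace ℝ ι → EuclideanSpace ℝ ι}
    (hboost : ∀ t ∈ Ioo 0 T₀, ∀ h x : EuclideanSpace ℝ ι,
      ((((Real.sqrt (ν * t) : ℝ) : ℂ), complexify h) : ℂ × EuclideanSpace ℂ ι) ∈ Ω →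
        U (((Real.sqrt (ν * t) : ℝ) : ℂ), complexify h) x = complexify (u t (x - (ν * t) • h)))
    (e : EuclideanSpace ℝ ι) (i : ι) {ψ : ℝ → ℂ} (hψ : Integrable ψ) (s₀ : ℝ) :
    AnalyticOnNhd ℝ (fun q : ℝ × EuclideanSpace ℝ ι => ∫ s, ((u (q.1 - s₀) (q.2 + s • e) i : ℝ) : ℂ) * ψ s)
      (Ioo s₀ (s₀ + T₀) ×ˢ (univ : Set (EuclideanSpace ℝ ι))) := by
  have hA := analyticOnNhd_linePairing_of_real_boost hν hΩ hΩreal hU hUc hUK hboost e i hψ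
  intro z hz
  obtain ⟨hz1, -⟩ := mem_prod.1 hz
  have hsh : AnalyticAt ℝ (fun q : ℝ × EuclideanSpace ℝ ι => (q.1 - s₀, q.2)) z :=
    (analyticAt_fst.sub analyticAt_const).prod analyticAt_snd
  have hmem : (z.1 - s₀, z.2) ∈ Ioo 0 T₀ ×ˢ (univ : Set (EuclideanSpace ℝ ι)) :=
    mem_prod.2 ⟨⟨by linarith [hz1.1], by linarith [hz1.2]⟩, mem_univ _⟩
  exact (hA _ hmem).comp_of_eq hsh rfl

end Chart

/-! ### The class statement: line pairings of an Oseen-ancient field -/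

variable {v : ℝ → EuclideanSpace ℝ (Fin 3) → EuclideanSpace ℝ (Fin 3)}

/-- **LINE PAIRINGS OF AN OSEEN-ANCIENT FIELD ARE REAL-ANALYTIC IN THE BASE POINT.**  For `v` in the Oseen-ancient
class 𝔄 (continuity on the open slab, bounds on every `(−∞,−δ)`, unit-viscosity Oseen-mild identity), every direction
`e`, component `i` and integrable weight `ψ : ℝ → ℂ`, the map `(t, y) ↦ ∫ v_i(t, y + s e) ψ(s) ds` is jointly
real-analytic on `(−∞,0) × ℝ³` (restart + complexified Oseen scheme + bounded-mild uniqueness, module docstring). -/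
theorem analyticOnNhd_linePairing (hcont : ContinuousOn (uncurry v) (Iio (0 : ℝ) ×ˢ univ))
    (hbdd : ∀ δ : ℝ, 0 < δ → ∃ B : ℝ, ∀ t < -δ, ∀ y : EuclideanSpace ℝ (Fin 3), ‖v t y‖ ≤ B)
    (hmild : ∀ s t : ℝ, s < t → t < 0 → ∀ y : EuclideanSpace ℝ (Fin 3),
      v t y = UnboundedOperators.heatExtension (v s) (t - s) y - oseenDuhamel 1 s v v t y)
    (e : EuclideanSpace ℝ (Fin 3)) (i : Fin 3) {ψ : ℝ → ℂ} (hψ : Integrable ψ) :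
    AnalyticOnNhd ℝ (fun q : ℝ × EuclideanSpace ℝ (Fin 3) => ∫ s, ((v q.1 (q.2 + s • e) i : ℝ) : ℂ) * ψ s)
      (Iio (0 : ℝ) ×ˢ (univ : Set (EuclideanSpace ℝ (Fin 3)))) := by
  classical
  intro z hz
  obtain ⟨ht, -⟩ := mem_prod.1 hz
  have ht0 : z.1 < 0 := ht
  -- the constants of the complexified scheme at `ν = 1`
  set KG : ℝ := freeConstC (Fin 3) with hKG_def
  set CB : ℝ := duhamelConstC (Fin 3) with hCB_def
  have hKG : 0 < KG := freeConstC_pos (Fin 3)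
  have hCB : 0 < CB := duhamelConstC_pos (Fin 3)
  set ε : ℝ := 1 / (64 * CB ^ 2 * KG ^ 2) with hε
  have hε0 : 0 < ε := by positivity
  -- a bound `M ≥ 1` for `v` on the sub-slab `t < z.1 / 2`
  obtain ⟨B, hB⟩ := hbdd (-(z.1 / 2)) (by linarith)
  set M : ℝ := max B 1 with hMdef
  have hM : 0 < M := one_pos.trans_le (le_max_right _ _)
  have hBM : B ≤ M := le_max_left _ _
  -- the lifespan `T₀ = ε/M²` and the smallness condition of the scheme (an equality)
  set T₀ : ℝ := ε * 1 / M ^ 2 with hT₀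
  have hT₀0 : 0 < T₀ := by positivity
  have hνT₀ : 1 * T₀ = (1 / (8 * CB * KG * M)) ^ 2 := by
    rw [hT₀, hε]; field_simp; ring
  have hsqrt : Real.sqrt (1 * T₀) = 1 / (8 * CB * KG * M) := by
    rw [hνT₀, Real.sqrt_sq (by positivity)]
  have hsmall : 8 * (duhamelConstC (Fin 3) * (Real.sqrt (1 * T₀) / 1)) * freeConstC (Fin 3) * M ≤ 1 := by
    rw [hsqrt, ← hCB_def, ← hKG_def]
    have h1 : 8 * (CB * (1 / (8 * CB * KG * M) / 1)) * KG * M = 1 := by field_simp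
    rw [h1]
  -- restart time `s₀ = z.1 - T₀/2` and the datum `b = v s₀`
  set s₀ : ℝ := z.1 - T₀ / 2 with hs₀
  have hs₀t : s₀ < z.1 := by rw [hs₀]; linarith
  have htT : z.1 < s₀ + T₀ := by rw [hs₀]; linarith
  have hs₀h : s₀ < z.1 / 2 := by linarith
  have hs₀0 : s₀ < 0 := by linarith
  set b : EuclideanSpace ℝ (Fin 3) → EuclideanSpace ℝ (Fin 3) := v s₀ with hbdef
  have hb : AEStronglyMeasurable b volume := (continuous_slice hcont hs₀0).aestronglyMeasurable
  have hbM : ∀ y, ‖b y‖ ≤ M := fun y => (hB s₀ (by linarith) y).trans hBM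
  -- the complexified local solution and its real restriction
  set U : ℂ × EuclideanSpace ℂ (Fin 3) → EuclideanSpace ℝ (Fin 3) → EuclideanSpace ℂ (Fin 3) :=
    picardLimitC 1 b with hUdef
  set u : ℝ → EuclideanSpace ℝ (Fin 3) → EuclideanSpace ℝ (Fin 3) := picardLimitReal 1 b with hudef
  have hUd : ∀ x, DifferentiableOn ℂ (fun p => U p x) (schemeDomain (ι := Fin 3) 1 T₀) := fun x =>
    differentiableOn_picardLimitC one_pos hb hM.le hbM hsmall x
  have hUc : ∀ p ∈ schemeDomain (ι := Fin 3) 1 T₀, Continuous (U p) := by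
    intro p hp
    have hg : Continuous (fun x : EuclideanSpace ℝ (Fin 3) =>
        ((p, x) : (ℂ × EuclideanSpace ℂ (Fin 3)) × EuclideanSpace ℝ (Fin 3))) :=
      continuous_const.prodMk continuous_id
    have h : Continuous (uncurry (picardLimitC 1 b) ∘ fun x : EuclideanSpace ℝ (Fin 3) => (p, x)) :=
      (continuousOn_picardLimitC one_pos hb hM.le hbM hsmall).comp_continuous hg
        fun x => mk_mem_prod hp (mem_univ x)
    exact h
  have hUK : ∀ p ∈ schemeDomain (ι := Fin 3) 1 T₀, ∀ x, ‖U p x‖ ≤ 2 * freeConstC (Fin 3) * M :=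
    fun p hp x => norm_picardLimitC_le one_pos hb hM.le hbM hsmall hp x
  have hreal : ∀ t ∈ Ioo 0 T₀, ∀ x : EuclideanSpace ℝ (Fin 3),
      U ((((Real.sqrt (1 * t) : ℝ) : ℂ)), 0) x = complexify (u t x) :=
    fun t ht' x => (complexify_picardLimitReal one_pos hb hM.le hbM hsmall ht' x).symm
  have hboost : ∀ t ∈ Ioo 0 T₀, ∀ h x : EuclideanSpace ℝ (Fin 3),
      ((((Real.sqrt (1 * t) : ℝ) : ℂ), complexify h) : ℂ × EuclideanSpace ℂ (Fin 3)) ∈ schemeDomain 1 T₀ →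
        U (((Real.sqrt (1 * t) : ℝ) : ℂ), complexify h) x = complexify (u t (x - (1 * t) • h)) :=
    fun t ht' h x hmem =>
      (isGalileanCovariantOn_picardLimitC one_pos hb hM.le hbM hsmall).real_boost one_pos hreal ht' h x hmem
  -- the line pairing of `u(· - s₀)` is analytic on `(s₀, s₀ + T₀) × ℝ³`
  have hA := analyticOnNhd_linePairing_shift_of_real_boost one_pos (isOpen_schemeDomain 1 T₀)
    (fun t ht' => sqrt_mem_schemeDomain one_pos ht'.1 ht'.2) hUd hUc hUK hboost e i hψ s₀
  -- identification `v = u(· - s₀)` on `(s₀, T₂)`, `T₂ = min (s₀ + T₀) (z.1/2)`, by bounded-mild uniqueness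
  obtain ⟨T₂, htT₂, hT₂w, hT₂h⟩ : ∃ T₂ : ℝ, z.1 < T₂ ∧ T₂ ≤ s₀ + T₀ ∧ T₂ ≤ z.1 / 2 :=
    ⟨min (s₀ + T₀) (z.1 / 2), lt_min htT (by linarith), min_le_left _ _, min_le_right _ _⟩
  have hT₂0 : T₂ < 0 := by linarith
  set M'' : ℝ := max M (2 * freeConstC (Fin 3) * M) with hM''
  have hM''0 : 0 ≤ M'' := hM.le.trans (le_max_left _ _)
  have hsub : Ioo s₀ T₂ ×ˢ (univ : Set (EuclideanSpace ℝ (Fin 3))) ⊆ Iio 0 ×ˢ univ :=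
    prod_mono (fun τ hτ => hτ.2.trans hT₂0) Subset.rfl
  have hum : AEStronglyMeasurable (uncurry v) (volume.restrict (Ioo s₀ T₂ ×ˢ univ)) :=
    (hcont.mono hsub).aestronglyMeasurable (measurableSet_Ioo.prod MeasurableSet.univ)
  have hushift : ContinuousOn (uncurry fun τ y => u (τ - s₀) y) (Ioo s₀ (s₀ + T₀) ×ˢ univ) := by
    have hc := continuousOn_uncurry_picardLimitReal one_pos hb hM.le hbM hsmall
    have hmaps : MapsTo (fun q : ℝ × EuclideanSpace ℝ (Fin 3) => (q.1 - s₀, q.2))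
        (Ioo s₀ (s₀ + T₀) ×ˢ univ) (Ioo 0 T₀ ×ˢ univ) := by
      intro q hq
      obtain ⟨hq1, -⟩ := mem_prod.1 hq
      exact mk_mem_prod ⟨by linarith [hq1.1], by linarith [hq1.2]⟩ (mem_univ _)
    have hg : Continuous (fun q : ℝ × EuclideanSpace ℝ (Fin 3) => (q.1 - s₀, q.2)) :=
      (continuous_fst.sub continuous_const).prodMk continuous_snd
    have h := hc.comp hg.continuousOn hmaps
    have hfun : (uncurry fun τ y => u (τ - s₀) y) =
        uncurry (picardLimitReal 1 b) ∘ fun q : ℝ × EuclideanSpace ℝ (Fin 3) => (q.1 - s₀, q.2) := by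
      funext q; rfl
    rw [hfun]; exact h
  have hvm : AEStronglyMeasurable (uncurry fun τ y => u (τ - s₀) y) (volume.restrict (Ioo s₀ T₂ ×ˢ univ)) :=
    (hushift.mono (prod_mono (Ioo_subset_Ioo_right hT₂w) Subset.rfl)).aestronglyMeasurable
      (measurableSet_Ioo.prod MeasurableSet.univ)
  have huM : ∀ τ ∈ Ioo s₀ T₂, ∀ y, ‖v τ y‖ ≤ M'' := fun τ hτ y =>
    ((hB τ (by linarith [hτ.2]) y).trans hBM).trans (le_max_left _ _)
  have hvM' : ∀ τ ∈ Ioo s₀ T₂, ∀ y, ‖u (τ - s₀) y‖ ≤ M'' := fun τ hτ y =>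
    (norm_picardLimitReal_le one_pos hb hM.le hbM hsmall ⟨by linarith [hτ.1], by linarith [hτ.2]⟩ y).trans
      (le_max_right _ _)
  have hu : ∀ τ ∈ Ioo s₀ T₂, v τ =ᵐ[volume] fun y =>
      UnboundedOperators.heatExtension (v s₀) (τ - s₀) y - oseenDuhamel 1 s₀ v v τ y :=
    fun τ hτ => Eventually.of_forall fun y => hmild s₀ τ hτ.1 (hτ.2.trans hT₂0) y
  have hv : ∀ τ ∈ Ioo s₀ T₂, (fun y => u (τ - s₀) y) =ᵐ[volume] fun y =>
      UnboundedOperators.heatExtension (v s₀) (τ - s₀) y -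
        oseenDuhamel 1 s₀ (fun τ y => u (τ - s₀) y) (fun τ y => u (τ - s₀) y) τ y := by
    intro τ hτ
    refine Eventually.of_forall fun y => ?_
    have hτ' : τ - s₀ ∈ Ioo 0 T₀ := ⟨by linarith [hτ.1], by linarith [hτ.2]⟩
    have h1 := picardLimitReal_eq one_pos hb hM.le hbM hsmall hτ' y
    have h3 : oseenDuhamel 1 s₀ (fun τ y => u (τ - s₀) y) (fun τ y => u (τ - s₀) y) τ y =
        oseenDuhamel 1 0 u u (τ - s₀) y := by
      have h := oseenDuhamel_translate 1 0 s₀ (fun τ y => u (τ - s₀) y) (fun τ y => u (τ - s₀) y)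
        (τ - s₀) y
      simp only [add_sub_cancel_right, zero_add, sub_add_cancel] at h
      exact h.symm
    show u (τ - s₀) y = UnboundedOperators.heatExtension (v s₀) (τ - s₀) y -
      oseenDuhamel 1 s₀ (fun τ y => u (τ - s₀) y) (fun τ y => u (τ - s₀) y) τ y
    rw [h3]
    rw [one_mul] at h1
    exact h1
  have hae : ∀ τ ∈ Ioo s₀ T₂, v τ =ᵐ[volume] fun y => u (τ - s₀) y :=
    oseenMild_bounded_unique (U := fun τ y => UnboundedOperators.heatExtension (v s₀) (τ - s₀) y)
      one_pos hM''0 hum hvm huM hvM' hu hv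
  have huc : ∀ τ ∈ Ioo s₀ T₂, Continuous fun y => u (τ - s₀) y := by
    intro τ hτ
    have hg : Continuous (fun y : EuclideanSpace ℝ (Fin 3) => ((τ, y) : ℝ × EuclideanSpace ℝ (Fin 3))) :=
      continuous_const.prodMk continuous_id
    have h : Continuous ((uncurry fun τ y => u (τ - s₀) y) ∘ fun y : EuclideanSpace ℝ (Fin 3) => (τ, y)) :=
      hushift.comp_continuous hg fun y => mk_mem_prod ⟨hτ.1, hτ.2.trans_le hT₂w⟩ (mem_univ y)
    exact h
  have heq : ∀ τ ∈ Ioo s₀ T₂, v τ = fun y => u (τ - s₀) y := fun τ hτ =>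
    ((continuous_slice hcont (hτ.2.trans hT₂0)).ae_eq_iff_eq volume (huc τ hτ)).1 (hae τ hτ)
  -- conclusion: near `z` the two pairings agree
  have hzmem : z ∈ Ioo s₀ (s₀ + T₀) ×ˢ (univ : Set (EuclideanSpace ℝ (Fin 3))) :=
    mem_prod.2 ⟨⟨hs₀t, htT⟩, mem_univ _⟩
  have hzmem' : z ∈ Ioo s₀ T₂ ×ˢ (univ : Set (EuclideanSpace ℝ (Fin 3))) :=
    mem_prod.2 ⟨⟨hs₀t, htT₂⟩, mem_univ _⟩
  refine (hA z hzmem).congr ?_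
  filter_upwards [(isOpen_Ioo.prod isOpen_univ).mem_nhds hzmem'] with q hq
  obtain ⟨hq1, -⟩ := mem_prod.1 hq
  simp only [heq q.1 hq1]

/-! ### Propagation from an open set to the slab -/

/-- **A line pairing that vanishes on a nonempty open space–time set vanishes on the whole slab** (identity theorem
for the real-analytic pairing on the connected slab). -/
theorem linePairing_eq_zero_of_open (hcont : ContinuousOn (uncurry v) (Iio (0 : ℝ) ×ˢ univ))
    (hbdd : ∀ δ : ℝ, 0 < δ → ∃ B : ℝ, ∀ t < -δ, ∀ y : EuclideanSpace ℝ (Fin 3), ‖v t y‖ ≤ B)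
    (hmild : ∀ s t : ℝ, s < t → t < 0 → ∀ y : EuclideanSpace ℝ (Fin 3),
      v t y = UnboundedOperators.heatExtension (v s) (t - s) y - oseenDuhamel 1 s v v t y)
    (e : EuclideanSpace ℝ (Fin 3)) (i : Fin 3) {ψ : ℝ → ℂ} (hψ : Integrable ψ)
    {W : Set (ℝ × EuclideanSpace ℝ (Fin 3))} (hW : IsOpen W) (hWne : W.Nonempty)
    (hWs : W ⊆ Iio (0 : ℝ) ×ˢ univ)
    (h0 : ∀ z ∈ W, ∫ s, ((v z.1 (z.2 + s • e) i : ℝ) : ℂ) * ψ s = 0) :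
    ∀ t < 0, ∀ y : EuclideanSpace ℝ (Fin 3), ∫ s, ((v t (y + s • e) i : ℝ) : ℂ) * ψ s = 0 := by
  have hA := analyticOnNhd_linePairing hcont hbdd hmild e i hψ
  obtain ⟨z₀, hz₀⟩ := hWne
  have hpre : IsPreconnected (Iio (0 : ℝ) ×ˢ (univ : Set (EuclideanSpace ℝ (Fin 3)))) :=
    ((convex_Iio 0).prod convex_univ).isPreconnected
  have hev : (fun q : ℝ × EuclideanSpace ℝ (Fin 3) => ∫ s, ((v q.1 (q.2 + s • e) i : ℝ) : ℂ) * ψ s) =ᶠ[𝓝 z₀] 0 := by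
    filter_upwards [hW.mem_nhds hz₀] with q hq
    exact h0 q hq
  have hE := hA.eqOn_zero_of_preconnected_of_eventuallyEq_zero hpre (hWs hz₀) hev
  intro t ht y
  exact hE (mk_mem_prod ht (mem_univ y))

/-- **Band-limitation of line restrictions propagates from a window to the slab.**  If on a nonempty open space–time
set `W` every line restriction `s ↦ v_i(t, y + s e)` (`(t,y) ∈ W`) has distributional Fourier support in `K`
(`HasFourierSupportIn`: `∫ v_i(t, y + s e) 𝓕φ(s) ds = 0` for all Schwartz `φ` supported off `K`), then so does every
line restriction at every negative time. -/
theorem hasFourierSupportIn_line_of_open (hcont : ContinuousOn (uncurry v) (Iio (0 : ℝ) ×ˢ univ))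
    (hbdd : ∀ δ : ℝ, 0 < δ → ∃ B : ℝ, ∀ t < -δ, ∀ y : EuclideanSpace ℝ (Fin 3), ‖v t y‖ ≤ B)
    (hmild : ∀ s t : ℝ, s < t → t < 0 → ∀ y : EuclideanSpace ℝ (Fin 3),
      v t y = UnboundedOperators.heatExtension (v s) (t - s) y - oseenDuhamel 1 s v v t y)
    (e : EuclideanSpace ℝ (Fin 3)) (i : Fin 3) (K : Set ℝ)
    {W : Set (ℝ × EuclideanSpace ℝ (Fin 3))} (hW : IsOpen W) (hWne : W.Nonempty)
    (hWs : W ⊆ Iio (0 : ℝ) ×ˢ univ)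
    (hK : ∀ z ∈ W, HasFourierSupportIn (fun s : ℝ => ((v z.1 (z.2 + s • e) i : ℝ) : ℂ)) K) :
    ∀ t < 0, ∀ y : EuclideanSpace ℝ (Fin 3),
      HasFourierSupportIn (fun s : ℝ => ((v t (y + s • e) i : ℝ) : ℂ)) K := by
  intro t ht y φ hφ
  have hψ : Integrable (𝓕 (φ : ℝ → ℂ)) := by
    rw [← SchwartzMap.fourier_coe]; exact (𝓕 φ).integrable
  exact linePairing_eq_zero_of_open hcont hbdd hmild e i hψ hW hWne hWs (fun z hz => hK z hz φ hφ) t ht y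

end Summit.NavierStokesRegularity.NavierStokesRegularity.Theorems.PoloidalWindowDoorPoloidalWindowRigidityLinePairing

end
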